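import Literature.AlgebraicGeometry.Motives.LefschetzStarProofs
import HarnessLib

/-!
# Existence and uniqueness of Kleiman's operator `Λ` (proof)

This file discharges the named fact
`Literature.AlgebraicGeometry.Motives.WeilCohomology.existsUnique_isLambdaOp`
(`Motives/Lefschetz`; Kleiman, *Algebraic cycles and the Weil conjectures* (1968), 1.4.2;
Kleiman, *The standard conjectures* (1994), §4): for a Weil cohomology theory `W` with the hard
Lefschetz property, `X` smooth projective of dimension `n` and `η` a hyperplane class, there is a
unique graded operator `Λ` on `H•(X)` of degree `-2` with `Λ x = 0` and `Λ (Lʳ⁺¹ x) = Lʳ x` for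
`x ∈ Pⁱ(X)` primitive and `i + r + 1 ≤ n`.

## The proof

Everything is elementary linear algebra from the hard Lefschetz bijections
`Lʳ : Hⁱ(X) ⥲ H²ⁿ⁻ⁱ(X)` (`W.HasHardLefschetz`) and the algebra axioms of `W`; the bookkeeping
`Lˢ ∘ Lʳ = Lʳ⁺ˢ` (`lefschetzPow_lefschetzPow`), the hard Lefschetz isomorphisms
(`hardLefschetzEquiv`) and the spanning of `Hᵃ(X)` by the Lefschetz summands `Lʲ Pⁱ(X)`
(`lefschetz_induction`, the spanning half of Kleiman 1968 1.4.1) are those of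
`Motives/LefschetzStarProofs`.

* *Existence* (`exists_isLambdaOp`): the explicit operator
  `Λ = (Lʳ⁺¹)⁻¹ ∘ Lʳ : Hᵃ → H²ⁿ⁺²⁻ᵃ → Hᵃ⁻²` in degrees `a ≤ n + 1` (`a + r = n + 1`;
  `exists_lambdaLow`), and `Λ = Lᵉ⁺¹ ∘ (Lᵉ⁺²)⁻¹ : Hⁿ⁺ᵉ⁺² → Hⁿ⁻ᵉ⁻² → Hⁿ⁺ᵉ` in degrees
  `n + 2 ≤ a ≤ 2n` (`exists_lambdaHigh`; this is the description of `Λ` in Murre's lectures,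
  Green–Murre–Voisin, *Algebraic cycles and Hodge theory*, LNM 1594, §7.7: "`Λ` is the unique
  linear map with `Λ ∘ Lʳ⁺² = Lʳ ∘ L` on `Hᵈ⁻ʳ⁻²`"), and `0` elsewhere; the operator is
  assembled degreewise (by choice from the two existence statements, so that this file declares
  theorems only). The identity `Λ (Lʳ⁺¹ x) = Lʳ x` then holds for *every* `x` in the stated
  range of degrees, and `Λ` kills primitive classes because `Lʳ x = 0` for `x ∈ Pᵃ`,
  `a + r = n + 1`.
* *Uniqueness* (`isLambdaOp_unique`): two such operators vanish off degree `-2` and agree on the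
  spanning classes `Lʲ x`, `x ∈ Pⁱ(X)` primitive, `i + j ≤ n` (`lefschetz_induction`).

## References

* S. Kleiman, *Algebraic cycles and the Weil conjectures*, in: Dix exposés sur la cohomologie des
  schémas, North-Holland (1968), §1.4 (1.4.1, 1.4.2). [Kleiman1968]
* S. Kleiman, *The standard conjectures*, in: Motives (Seattle 1991), Proc. Sympos. Pure Math. 55
  Part 1 (1994), §4. [Kleiman1994]
* J. Murre, *Algebraic cycles and algebraic aspects of cohomology and K-theory*, in: Green–Murre–
  Voisin, *Algebraic Cycles and Hodge Theory* (Torino 1993), Lecture Notes in Math. 1594 (1994),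
  §7.7 (held: `book:green1994-…`, PDF pp. 122–123). [MurreTorino1994]
-/

universe u v

open CategoryTheory AlgebraicGeometry

noncomputable section

namespace Literature.AlgebraicGeometry.Motives

namespace WeilCohomology

variable {k : Type u} [Field k] {K : Type v} [Field K] [CharZero K] (W : WeilCohomology k K)
variable {n : ℕ} {X : SchemeOver k} {η : W.obj X 2}

/-- `L⁰ = id`, i.e. `x ∪ η⁰ = x ∪ 1 = x` (`cup_comm`, `one_cup`); a private copy of
`WeilCohomology.lefschetzPow_zero_apply` (`Motives/WeilCohomologyProofs`), kept local so that
this file does not import the cycle-map material of that module. [folklore] -/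
private theorem lefschetzPow_zero_apply' (hX : IsSmoothProjective n X) (η : W.obj X 2) {i : ℕ}
    (h : i + 2 * 0 = i) (x : W.obj X i) : W.lefschetzPow X η 0 i i h x = x := by
  show W.cup h x (W.one X) = x
  rw [W.cup_comm hX h (Nat.zero_add i) x (W.one X), W.one_cup hX (Nat.zero_add i) x]
  simp

/-! ## Existence: the explicit operator `Λ` -/

/-- The component `Hⁱ → Hʲ = Hⁱ⁻²` of `Λ` in degrees `i ≤ n + 1` exists: `f = (Lʳ′⁺¹)⁻¹ ∘ Lʳ′`
with `i + r′ = n + 1`, through `Hᵐ = H²ⁿ⁺²⁻ⁱ` (hard Lefschetz for `Lʳ′⁺¹ : Hʲ ⥲ Hᵐ`), satisfies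
`f (Lʳ⁺¹ x) = Lʳ x` for every `x` and kills `ker Lʳ′ ⊇ Pⁱ` (Kleiman 1968 1.4.2, low degrees; for
`i ≤ n` this `f` is `lowerOp` of `Motives/LefschetzStarProofs`). [cite: Kleiman1968, 1.4.2] -/
theorem exists_lambdaLow (hL : W.HasHardLefschetz) (hX : IsSmoothProjective n X)
    (hη : W.IsHyperplaneClass X η) (i j r' m : ℕ) (hj : j + 2 = i) (hr' : i + r' = n + 1)
    (hm : i + 2 * r' = m) :
    ∃ f : W.obj X i →ₗ[K] W.obj X j,
      (∀ {a : ℕ} (x : W.obj X a) (r : ℕ) (h₁ : a + 2 * (r + 1) = i) (h₂ : a + 2 * r = j),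
          f (W.lefschetzPow X η (r + 1) a i h₁ x) = W.lefschetzPow X η r a j h₂ x) ∧
        ∀ x : W.obj X i, W.lefschetzPow X η r' i m hm x = 0 → f x = 0 := by
  refine ⟨(W.hardLefschetzEquiv hL hX hη j (r' + 1) m (by omega) (by omega)).symm.toLinearMap ∘ₗ
      W.lefschetzPow X η r' i m hm, fun x r h₁ h₂ ↦ ?_, fun x hx ↦ ?_⟩
  · rw [LinearMap.comp_apply, LinearEquiv.coe_coe, LinearEquiv.symm_apply_eq,
      hardLefschetzEquiv_apply,
      W.lefschetzPow_lefschetzPow hX η (t := r + r' + 1) (by omega) h₁ hm (by omega) x,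
      W.lefschetzPow_lefschetzPow hX η (s := r' + 1) (t := r + r' + 1) (by omega) h₂
        (show j + 2 * (r' + 1) = m by omega) (by omega) x]
  · rw [LinearMap.comp_apply, LinearEquiv.coe_coe, hx, map_zero]

/-- The component `Hᵃ → Hᵇ = Hᵃ⁻²` of `Λ` in degrees `a = n + e + 2 ≥ n + 2` exists:
`f = Lᵉ⁺¹ ∘ (Lᵉ⁺²)⁻¹` through `Hᶜ = Hⁿ⁻ᵉ⁻²` (hard Lefschetz for `Lᵉ⁺² : Hᶜ ⥲ Hᵃ`; Murre's
description `Λ ∘ Lᵉ⁺² = Lᵉ⁺¹`, Green–Murre–Voisin LNM 1594 §7.7) satisfies `f (Lʳ⁺¹ x) = Lʳ x`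
for every `x` and `r = d + e + 1` (Kleiman 1968 1.4.2, high degrees). [cite: Kleiman1968, 1.4.2] -/
theorem exists_lambdaHigh (hL : W.HasHardLefschetz) (hX : IsSmoothProjective n X)
    (hη : W.IsHyperplaneClass X η) (e a b c : ℕ) (ha : n + e + 2 = a) (hb : n + e = b)
    (hc : c + e + 2 = n) :
    ∃ f : W.obj X a →ₗ[K] W.obj X b,
      ∀ {i : ℕ} (x : W.obj X i) (d : ℕ) (h₁ : i + 2 * (d + e + 1 + 1) = a)
        (h₂ : i + 2 * (d + e + 1) = b),
        f (W.lefschetzPow X η (d + e + 1 + 1) i a h₁ x) =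
          W.lefschetzPow X η (d + e + 1) i b h₂ x := by
  refine ⟨W.lefschetzPow X η (e + 1) c b (by omega) ∘ₗ
      (W.hardLefschetzEquiv hL hX hη c (e + 2) a hc (by omega)).symm.toLinearMap,
    fun {i} x d h₁ h₂ ↦ ?_⟩
  rw [LinearMap.comp_apply, LinearEquiv.coe_coe,
    ← W.lefschetzPow_lefschetzPow hX η (r := d) (s := e + 2) (t := d + e + 1 + 1) (by omega)
      (show i + 2 * d = c by omega) (by omega) h₁ x,
    W.hardLefschetzEquiv_symm_apply_lefschetzPow]
  exact W.lefschetzPow_lefschetzPow hX η (by omega) _ _ h₂ x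

/-- **Existence of `Λ`** (Kleiman 1968 1.4.2): under hard Lefschetz there is a graded operator
satisfying `IsLambdaOp n η`, assembled degreewise from `exists_lambdaLow` (degrees `≤ n + 1`),
`exists_lambdaHigh` (degrees `n + 2, …, 2n`) and `0` (degrees `> 2n`, where `Hᵃ = 0`, and off
degree `-2`). [cite: Kleiman1968, 1.4.2] -/
theorem exists_isLambdaOp (hL : W.HasHardLefschetz) (hX : IsSmoothProjective n X)
    (hη : W.IsHyperplaneClass X η) : ∃ Λ : W.GradedOp X X, W.IsLambdaOp n η Λ := by
  classical
  have low : ∀ a b : ℕ, b + 2 = a → a ≤ n + 1 →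
      ∃ f : W.obj X a →ₗ[K] W.obj X b,
        (∀ {a' : ℕ} (x : W.obj X a') (r : ℕ) (h₁ : a' + 2 * (r + 1) = a) (h₂ : a' + 2 * r = b),
            f (W.lefschetzPow X η (r + 1) a' a h₁ x) = W.lefschetzPow X η r a' b h₂ x) ∧
          ∀ x : W.obj X a,
            W.lefschetzPow X η (n + 1 - a) a (a + 2 * (n + 1 - a)) rfl x = 0 → f x = 0 :=
    fun a b hj ha ↦ W.exists_lambdaLow hL hX hη a b (n + 1 - a) _ hj (by omega) rfl
  have high : ∀ a b : ℕ, b + 2 = a → ¬ a ≤ n + 1 → a ≤ 2 * n →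
      ∃ f : W.obj X a →ₗ[K] W.obj X b,
        ∀ {i : ℕ} (x : W.obj X i) (d : ℕ) (h₁ : i + 2 * (d + (a - (n + 2)) + 1 + 1) = a)
          (h₂ : i + 2 * (d + (a - (n + 2)) + 1) = b),
          f (W.lefschetzPow X η (d + (a - (n + 2)) + 1 + 1) i a h₁ x) =
            W.lefschetzPow X η (d + (a - (n + 2)) + 1) i b h₂ x :=
    fun a b hj ha ha' ↦ W.exists_lambdaHigh hL hX hη (a - (n + 2)) a b (2 * n - a) (by omega)
      (by omega) (by omega)
  refine ⟨fun a b ↦ if hj : b + 2 = a then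
      (if ha : a ≤ n + 1 then (low a b hj ha).choose
        else if ha' : a ≤ 2 * n then (high a b hj ha ha').choose else 0)
      else 0, fun a b hj ↦ ?_, fun i x hx j ↦ ?_, fun i x _ r j₁ j₂ h₁ h₂ hle ↦ ?_⟩
  · -- components off degree `-2` vanish
    simp only [dif_neg hj]
  · -- `Λ` kills primitive classes
    by_cases hj : j + 2 = i
    · simp only [dif_pos hj]
      split_ifs with ha ha'
      · exact (low i j hj ha).choose_spec.2 x (hx.2 (n + 1 - i) _ rfl (by omega))
      · rw [hx.1 (by omega), map_zero]
      · rw [hx.1 (by omega), map_zero]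
    · simp only [dif_neg hj, LinearMap.zero_apply]
  · -- `Λ (Lʳ⁺¹ x) = Lʳ x`
    have hj : j₂ + 2 = j₁ := by omega
    simp only [dif_pos hj]
    split_ifs with ha ha'
    · exact (low j₁ j₂ hj ha).choose_spec.1 x r h₁ h₂
    · obtain ⟨d, rfl⟩ : ∃ d, r = d + (j₁ - (n + 2)) + 1 := ⟨r - (j₁ - (n + 2)) - 1, by omega⟩
      exact (high j₁ j₂ hj ha ha').choose_spec x d h₁ h₂
    · exfalso; omega

/-! ## Uniqueness and the named fact -/

/-- **Uniqueness of `Λ`** (Kleiman 1968 1.4.2): two graded operators satisfying `IsLambdaOp`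
agree, since both vanish off degree `-2` and agree on the spanning classes `Lʲ x`, `x ∈ Pⁱ(X)`
primitive, `i + j ≤ n` (`lefschetz_induction`). [cite: Kleiman1968, 1.4.2] -/
theorem isLambdaOp_unique (hL : W.HasHardLefschetz) (hX : IsSmoothProjective n X)
    (hη : W.IsHyperplaneClass X η) {Λ₁ Λ₂ : W.GradedOp X X} (h₁ : W.IsLambdaOp n η Λ₁)
    (h₂ : W.IsLambdaOp n η Λ₂) : Λ₁ = Λ₂ := by
  funext a b
  by_cases hab : b + 2 = a
  · subst hab
    refine LinearMap.ext fun y ↦ ?_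
    refine W.lefschetz_induction hL hX hη (C := fun y ↦ Λ₁ (b + 2) b y = Λ₂ (b + 2) b y)
      ?_ ?_ ?_ y
    · simp only [map_zero]
    · intro y z hy hz
      show Λ₁ (b + 2) b (y + z) = Λ₂ (b + 2) b (y + z)
      rw [map_add, map_add, show Λ₁ (b + 2) b y = Λ₂ (b + 2) b y from hy,
        show Λ₁ (b + 2) b z = Λ₂ (b + 2) b z from hz]
    · intro i j h x hx hij
      show Λ₁ (b + 2) b _ = Λ₂ (b + 2) b _
      rcases j with _ | r
      · obtain rfl : i = b + 2 := by omega
        rw [W.lefschetzPow_zero_apply' hX, h₁.2.1 _ x hx b, h₂.2.1 _ x hx b]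
      · rw [h₁.2.2 i x hx r (b + 2) b h (by omega) hij, h₂.2.2 i x hx r (b + 2) b h (by omega) hij]
  · rw [h₁.1 a b hab, h₂.1 a b hab]

/-- **Existence and uniqueness of `Λ`** (Kleiman 1968 1.4.2; Kleiman 1994 §4), discharging the
named fact `existsUnique_isLambdaOp` of `Motives/Lefschetz`: under hard Lefschetz, for `X` smooth
projective of dimension `n` and `η` a hyperplane class there is exactly one graded operator
satisfying `IsLambdaOp n η` (`exists_isLambdaOp`, `isLambdaOp_unique`).
[cite: Kleiman1968, 1.4.2] -/
theorem existsUnique_isLambdaOp_holds : W.existsUnique_isLambdaOp (n := n) (X := X) (η := η) := by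
  intro hL hX hη
  obtain ⟨Λ, hΛ⟩ := W.exists_isLambdaOp hL hX hη
  exact ⟨Λ, hΛ, fun Λ' hΛ' ↦ W.isLambdaOp_unique hL hX hη hΛ' hΛ⟩

end WeilCohomology

end Literature.AlgebraicGeometry.Motives

end
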